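import Mathlib
import Literature.Probability.LatticeModels.GKSInequalities
import Summits.CriticalPhenomena.Ising3DConformalLimit.Theorems.PrecisionLaplacianInverseMFerromagnetEntryNonposOfPcov
import Summits.CriticalPhenomena.Ising3DConformalLimit.Theorems.PrecisionLaplacianInverseMFerromagnetOddGramDuality
import Summits.CriticalPhenomena.Ising3DConformalLimit.Theorems.PrecisionLaplacianInverseMFerromagnetAfPrecisionNonnegFour
import HarnessLib

/-!
# Crux `PrecisionLaplacian.InverseMFerromagnet` (stmt-CriticalPhenomena-4798), line `Sketch` —
# `helper_law2_four`: the open core `Law₂` on four sites, for all couplings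

THEOREM-ONLY file (no definitions).  `Law₂` (registered `stub_law2`, the one open leaf of the
line) says: for every zero-field pair ferromagnet and all 3-sets `A, B`,
`v_Aᵀ Σ⁻¹ v_B ≤ ⟨σ_Aσ_B⟩` with `v_A(w) = ⟨σ_Aσ_w⟩`, i.e. the partial covariance of the cubics
`σ_A, σ_B` given the linear span of the single spins is nonnegative.  Here we prove it on `Fin 4`
(the first size at which it is not vacuous), for arbitrary multigraph supports and couplings.

Proof (ferro/antiferro duality).  With `u = σ_0σ_1σ_2σ_3`, a 3-set is `univ ∖ {i}` and
`σ_{univ∖i} = u σ_i`; put `Σ_pq = ⟨σ_pσ_q⟩_K`, `Ũ_pq = ⟨u σ_pσ_q⟩_K` and `Σ', Ũ'` for the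
antiferromagnet `-K`.  The odd-monomial Gram duality (`helper_odd_gram_duality`, landed p128610) `Σ_{T odd} ⟨σ_Sσ_T⟩_K ⟨σ_Tσ_U⟩_{-K} = c·[S = U]`, `c = 4⁴/(Z Z') > 0`,
read on singles and triples, gives `ΣΣ' + ŨŨ' = c·1` and `ΣŨ' + ŨΣ' = 0`, whence
`(Σ − ŨΣ⁻¹Ũ)·Σ' = c·1`, i.e. the `Law₂` bracket matrix is `Σ − ŨΣ⁻¹Ũ = c·Σ'⁻¹`.  Its diagonal is
positive (`Σ'` is positive definite) and its off-diagonal entries are `≥ 0` because the 4-site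
ANTIferromagnet has nonnegative off-diagonal precision entries (`helper_af_precision_nonneg_four`,
landed p129018).  `law2_four_of` is the assembly with both inputs as hypotheses; `helper_law2_four` instantiates it.
-/

namespace Summit.CriticalPhenomena.Ising3DConformalLimit.Cruxes.InverseMFerromagnet.PartialCovarianceLadder

open Literature.Probability.LatticeModels Finset Matrix

/-- `σ_{univ ∖ {k}} = u·σ_k` with `u = σ_univ` (since `σ_k² = 1`). [folklore] -/
theorem l2f_spinProduct_erase {n : ℕ} (k : Fin n) (ω : SpinConfig (Fin n)) :
    spinProduct (Finset.univ.erase k) ω = spinProduct Finset.univ ω * spinAt k ω := by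
  have h := Finset.prod_erase_mul (Finset.univ) (fun x => spinAt x ω) (Finset.mem_univ k)
  simp only [spinProduct]
  rw [← h, mul_assoc, spinAt_mul_self, mul_one]

/-- A 3-subset of `Fin 4` is the complement of a point. [folklore] -/
theorem l2f_card_three (A : Finset (Fin 4)) (hA : A.card = 3) :
    ∃ i : Fin 4, A = Finset.univ.erase i := by
  have hc : Aᶜ.card = 1 := by rw [Finset.card_compl, hA]; rfl
  obtain ⟨i, hi⟩ := Finset.card_eq_one.1 hc
  refine ⟨i, ?_⟩
  have : A = ({i} : Finset (Fin 4))ᶜ := by rw [← hi, compl_compl]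
  rw [this, Finset.compl_eq_univ_sdiff, Finset.sdiff_singleton_eq_erase]

/-- The odd subsets of `Fin 4` are the singletons and the complements of points. [folklore] -/
theorem l2f_odd_sets :
    (Finset.univ : Finset (Fin 4)).powerset.filter (fun T => Odd T.card)
      = (Finset.univ.image fun k : Fin 4 => ({k} : Finset (Fin 4)))
        ∪ (Finset.univ.image fun k : Fin 4 => Finset.univ.erase k) := by
  decide

/-- The two families are disjoint. [folklore] -/
theorem l2f_odd_sets_disjoint :
    Disjoint (Finset.univ.image fun k : Fin 4 => ({k} : Finset (Fin 4)))
      (Finset.univ.image fun k : Fin 4 => Finset.univ.erase k) := by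
  decide

/-- Sums over the odd subsets of `Fin 4` split into singletons and co-points. [folklore] -/
theorem l2f_sum_odd (f : Finset (Fin 4) → ℝ) :
    ∑ T ∈ (Finset.univ : Finset (Fin 4)).powerset.filter (fun T => Odd T.card), f T
      = ∑ k : Fin 4, f {k} + ∑ k : Fin 4, f (Finset.univ.erase k) := by
  rw [l2f_odd_sets, Finset.sum_union l2f_odd_sets_disjoint,
    Finset.sum_image (fun a _ b _ h => Finset.singleton_injective h),
    Finset.sum_image (fun a _ b _ h => (Finset.erase_inj _ (Finset.mem_univ a)).1 h)]

/-- `u² = 1` pointwise, `u = σ_univ`. [folklore] -/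
theorem l2f_u_mul_u {n : ℕ} (ω : SpinConfig (Fin n)) :
    spinProduct Finset.univ ω * spinProduct Finset.univ ω = 1 :=
  spinProduct_mul_self _ _

/-- **`Law₂` on four sites from the duality and the antiferromagnetic sign** (the assembly;
both inputs are landed helper stubs of the crux, taken as hypotheses here and discharged below). [folklore] -/
theorem law2_four_of
    (hdual : ∀ (n m : ℕ) (K : Fin m → ℝ) (C : Fin m → Finset (Fin n)), (∀ i, (C i).card = 2) →
      ∀ (S U : Finset (Fin n)), Odd U.card →
        ∑ T ∈ (Finset.univ : Finset (Fin n)).powerset.filter (fun T => Odd T.card),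
            gksExpect Finset.univ K C (fun ω => spinProduct S ω * spinProduct T ω)
              * gksExpect Finset.univ (fun i => -K i) C (fun ω => spinProduct T ω * spinProduct U ω)
          = if S = U then (4 : ℝ) ^ n / (gksSum Finset.univ K C (fun _ => 1)
              * gksSum Finset.univ (fun i => -K i) C (fun _ => 1)) else 0)
    (haf : ∀ (m : ℕ) (K : Fin m → ℝ) (C : Fin m → Finset (Fin 4)), (∀ i, 0 ≤ K i) →
      (∀ i, (C i).card = 2) → ∀ x y : Fin 4, x ≠ y →
        0 ≤ (Matrix.of fun p q : Fin 4 =>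
          gksExpect Finset.univ (fun i => -K i) C (fun ω => spinAt p ω * spinAt q ω))⁻¹ x y) :
    ∀ (m : ℕ) (K : Fin m → ℝ) (C : Fin m → Finset (Fin 4)), (∀ i, 0 ≤ K i) → (∀ i, (C i).card = 2) →
      ∀ (A B : Finset (Fin 4)), A.card = 3 → B.card = 3 →
        dotProduct (fun w => gksExpect Finset.univ K C (fun ω => spinProduct A ω * spinAt w ω))
          (((Matrix.of fun p q : Fin 4 =>
              gksExpect Finset.univ K C (fun ω => spinAt p ω * spinAt q ω))⁻¹).mulVec
            (fun w => gksExpect Finset.univ K C (fun ω => spinProduct B ω * spinAt w ω)))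
        ≤ gksExpect Finset.univ K C (fun ω => spinProduct A ω * spinProduct B ω) := by
  intro m K C hK hC A B hA hB
  obtain ⟨i, rfl⟩ := l2f_card_three A hA
  obtain ⟨j, rfl⟩ := l2f_card_three B hB
  -- the four matrices
  set Sg : Matrix (Fin 4) (Fin 4) ℝ :=
    Matrix.of fun p q : Fin 4 => gksExpect Finset.univ K C (fun ω => spinAt p ω * spinAt q ω) with hSg
  set Sa : Matrix (Fin 4) (Fin 4) ℝ := Matrix.of fun p q : Fin 4 =>
    gksExpect Finset.univ (fun i => -K i) C (fun ω => spinAt p ω * spinAt q ω) with hSa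
  set Ug : Matrix (Fin 4) (Fin 4) ℝ := Matrix.of fun p q : Fin 4 =>
    gksExpect Finset.univ K C (fun ω => spinProduct Finset.univ ω * spinAt p ω * spinAt q ω) with hUg
  set Ua : Matrix (Fin 4) (Fin 4) ℝ := Matrix.of fun p q : Fin 4 =>
    gksExpect Finset.univ (fun i => -K i) C
      (fun ω => spinProduct Finset.univ ω * spinAt p ω * spinAt q ω) with hUa
  set c : ℝ := (4 : ℝ) ^ 4 / (gksSum Finset.univ K C (fun _ => 1)
      * gksSum Finset.univ (fun i => -K i) C (fun _ => 1)) with hc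
  have hcpos : 0 < c := by
    rw [hc]
    exact div_pos (by norm_num) (mul_pos (gksSum_one_pos _ _ _) (gksSum_one_pos _ _ _))
  have hSg_pd : Sg.PosDef := schur_posDef 4 m K C
  have hSa_pd : Sa.PosDef := schur_posDef 4 m (fun i => -K i) C
  -- pointwise identities
  have e_single : ∀ (p : Fin 4) (ω : SpinConfig (Fin 4)), spinProduct {p} ω = spinAt p ω :=
    fun p ω => by simp [spinProduct]
  have e_erase : ∀ (p : Fin 4) (ω : SpinConfig (Fin 4)),
      spinProduct (Finset.univ.erase p) ω = spinProduct Finset.univ ω * spinAt p ω :=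
    fun p ω => l2f_spinProduct_erase p ω
  -- (I) and (II) from the duality
  have hI : Sg * Sa + Ug * Ua = c • (1 : Matrix (Fin 4) (Fin 4) ℝ) := by
    ext p q
    have h := hdual 4 m K C hC {p} {q} (by simp)
    rw [l2f_sum_odd] at h
    rw [Matrix.add_apply, Matrix.mul_apply, Matrix.mul_apply, Matrix.smul_apply, Matrix.one_apply]
    have h1 : ∀ k : Fin 4, gksExpect Finset.univ K C (fun ω => spinProduct {p} ω * spinProduct {k} ω)
        * gksExpect Finset.univ (fun i => -K i) C (fun ω => spinProduct {k} ω * spinProduct {q} ω)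
        = Sg p k * Sa k q := fun k => by
      simp only [hSg, hSa, Matrix.of_apply, e_single]
    have h2 : ∀ k : Fin 4, gksExpect Finset.univ K C
          (fun ω => spinProduct {p} ω * spinProduct (Finset.univ.erase k) ω)
        * gksExpect Finset.univ (fun i => -K i) C
          (fun ω => spinProduct (Finset.univ.erase k) ω * spinProduct {q} ω)
        = Ug p k * Ua k q := fun k => by
      simp only [hUg, hUa, Matrix.of_apply, e_single, e_erase]
      congr 1; first | rfl | (congr 1; funext ω; ring)
    simp only [h1, h2] at h
    rw [h]
    by_cases hpq : p = q
    · subst hpq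
      simp [hc]
    · have hne : ({p} : Finset (Fin 4)) ≠ {q} := fun h' => hpq (Finset.singleton_injective h')
      simp [hne, hpq]
  have hII : Sg * Ua + Ug * Sa = 0 := by
    ext p q
    have hodd : Odd (Finset.univ.erase q : Finset (Fin 4)).card := by
      rw [Finset.card_erase_of_mem (Finset.mem_univ q)]; decide
    have h := hdual 4 m K C hC {p} (Finset.univ.erase q) hodd
    rw [l2f_sum_odd] at h
    have hne : ({p} : Finset (Fin 4)) ≠ Finset.univ.erase q := by
      intro h'
      have := congrArg Finset.card h'
      rw [Finset.card_singleton, Finset.card_erase_of_mem (Finset.mem_univ q)] at this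
      exact absurd this (by decide)
    rw [if_neg hne] at h
    rw [Matrix.add_apply, Matrix.mul_apply, Matrix.mul_apply, Matrix.zero_apply]
    have h1 : ∀ k : Fin 4, gksExpect Finset.univ K C (fun ω => spinProduct {p} ω * spinProduct {k} ω)
        * gksExpect Finset.univ (fun i => -K i) C
          (fun ω => spinProduct {k} ω * spinProduct (Finset.univ.erase q) ω)
        = Sg p k * Ua k q := fun k => by
      simp only [hSg, hUa, Matrix.of_apply, e_single, e_erase]
      congr 1; first | rfl | (congr 1; funext ω; ring)
    have h2 : ∀ k : Fin 4, gksExpect Finset.univ K C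
          (fun ω => spinProduct {p} ω * spinProduct (Finset.univ.erase k) ω)
        * gksExpect Finset.univ (fun i => -K i) C
          (fun ω => spinProduct (Finset.univ.erase k) ω * spinProduct (Finset.univ.erase q) ω)
        = Ug p k * Sa k q := fun k => by
      simp only [hUg, hSa, Matrix.of_apply, e_single, e_erase]
      have hu2 : (fun ω => spinProduct Finset.univ ω * spinAt k ω * (spinProduct Finset.univ ω * spinAt q ω))
          = fun ω => spinAt k ω * spinAt q ω := by
        funext ω
        have hu := l2f_u_mul_u ω
        linear_combination (spinAt k ω * spinAt q ω) * hu
      rw [hu2]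
      congr 1; first | rfl | (congr 1; funext ω; ring)
    simp only [h1, h2] at h
    exact h
  -- algebra: (Sg - Ug Sg⁻¹ Ug) * Sa = c • 1, hence Sg - Ug Sg⁻¹ Ug = c • Sa⁻¹
  have hSg_unit : IsUnit Sg.det := (Matrix.isUnit_iff_isUnit_det Sg).mp hSg_pd.isUnit
  have hSa_unit : IsUnit Sa.det := (Matrix.isUnit_iff_isUnit_det Sa).mp hSa_pd.isUnit
  have hUgSa : Ug * Sa = -(Sg * Ua) := eq_neg_of_add_eq_zero_right hII
  have hP : (Sg - Ug * Sg⁻¹ * Ug) * Sa = c • (1 : Matrix (Fin 4) (Fin 4) ℝ) := by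
    rw [Matrix.sub_mul, Matrix.mul_assoc (Ug * Sg⁻¹), hUgSa, Matrix.mul_neg, sub_neg_eq_add,
      Matrix.mul_assoc Ug, ← Matrix.mul_assoc Sg⁻¹, Matrix.nonsing_inv_mul _ hSg_unit,
      Matrix.one_mul]
    exact hI
  have hPeq : Sg - Ug * Sg⁻¹ * Ug = c • Sa⁻¹ := by
    have h : (Sg - Ug * Sg⁻¹ * Ug) * Sa * Sa⁻¹ = (c • (1 : Matrix (Fin 4) (Fin 4) ℝ)) * Sa⁻¹ := by
      rw [hP]
    rwa [Matrix.mul_assoc, Matrix.mul_nonsing_inv _ hSa_unit, Matrix.mul_one,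
      Matrix.smul_mul, Matrix.one_mul] at h
  -- the bracket entry (i, j) is nonnegative
  have hentry : 0 ≤ (Sg - Ug * Sg⁻¹ * Ug) i j := by
    rw [hPeq, Matrix.smul_apply, smul_eq_mul]
    refine mul_nonneg hcpos.le ?_
    by_cases hij : i = j
    · subst hij
      exact (hSa_pd.inv.diag_pos).le
    · exact haf m K C hK hC i j hij
  -- rewrite the goal in terms of the matrices
  have hsymmU : ∀ p q, Ug p q = Ug q p := fun p q => by
    simp only [hUg, Matrix.of_apply]
    congr 1; funext ω; ring
  have lhs : dotProduct
        (fun w => gksExpect Finset.univ K C (fun ω => spinProduct (Finset.univ.erase i) ω * spinAt w ω))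
        (Sg⁻¹.mulVec fun w =>
          gksExpect Finset.univ K C (fun ω => spinProduct (Finset.univ.erase j) ω * spinAt w ω))
      = (Ug * Sg⁻¹ * Ug) i j := by
    have hv : ∀ (p w : Fin 4), gksExpect Finset.univ K C
        (fun ω => spinProduct (Finset.univ.erase p) ω * spinAt w ω) = Ug p w := fun p w => by
      simp only [hUg, Matrix.of_apply, e_erase]
    simp only [hv, dotProduct, Matrix.mulVec, Matrix.mul_apply, Finset.mul_sum, Finset.sum_mul]
    rw [Finset.sum_comm]
    refine Finset.sum_congr rfl fun z _ => Finset.sum_congr rfl fun w _ => ?_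
    rw [hsymmU j z]
    ring
  have rhs : gksExpect Finset.univ K C
        (fun ω => spinProduct (Finset.univ.erase i) ω * spinProduct (Finset.univ.erase j) ω)
      = Sg i j := by
    simp only [hSg, Matrix.of_apply, e_erase]
    congr 1; funext ω
    have hu := l2f_u_mul_u ω
    linear_combination (spinAt i ω * spinAt j ω) * hu
  rw [lhs, rhs]
  have := hentry
  rw [Matrix.sub_apply] at this
  linarith

/-- **Registered helper `helper_law2_four`: `Law₂` (the open core `stub_law2`) ON FOUR SITES, for every
multigraph support and all couplings `K ≥ 0`** — for all 3-sets `A, B ⊆ Fin 4`,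
`v_Aᵀ Σ⁻¹ v_B ≤ ⟨σ_Aσ_B⟩` with `v_A(w) = ⟨σ_Aσ_w⟩`.  First nontrivial rung of the open core (on `≤ 3`
sites it is vacuous); by the landed C2 (`c2_law2_res`, same `n`) it yields IM at every non-adjacent pair of
degree-3 vertices with `|∂x ∩ ∂y| = 2` of every 6-site ferromagnet.  Proof: `law2_four_of` with the landed
`helper_odd_gram_duality` (p128610) and `helper_af_precision_nonneg_four` (p129018). [folklore] -/
theorem helper_law2_four :
    ∀ (m : ℕ) (K : Fin m → ℝ) (C : Fin m → Finset (Fin 4)), (∀ i, 0 ≤ K i) → (∀ i, (C i).card = 2) →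
      ∀ (A B : Finset (Fin 4)), A.card = 3 → B.card = 3 →
        dotProduct (fun w => gksExpect Finset.univ K C (fun ω => spinProduct A ω * spinAt w ω))
          (((Matrix.of fun p q : Fin 4 =>
              gksExpect Finset.univ K C (fun ω => spinAt p ω * spinAt q ω))⁻¹).mulVec
            (fun w => gksExpect Finset.univ K C (fun ω => spinProduct B ω * spinAt w ω)))
        ≤ gksExpect Finset.univ K C (fun ω => spinProduct A ω * spinProduct B ω) :=
  law2_four_of helper_odd_gram_duality helper_af_precision_nonneg_four

end Summit.CriticalPhenomena.Ising3DConformalLimit.Cruxes.InverseMFerromagnet.PartialCovarianceLadder
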